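import Summits.QuantumFields.YangMills.Theses.ParabolicTrajectory
import Literature.MathematicalPhysics.QuantumFieldTheory.BalabanBanachStep
import Summits.QuantumFields.YangMills.Theorems.ParabolicTrajectoryLatticeGapOnTrajectoryScalingDefs

/-!
# Route `ParabolicTrajectory`, crux `LatticeGapOnTrajectory` (stmt-QuantumFields-10523),
# line `trajectory-gap-scaling`: stub `stub_scaleIdentification`

`stub_scaleIdentification : ScaleIdentification` — where the crux's tuning is consumed: along an
`M`-adic scheme `a_k = (M^(n k))⁻¹`, `β_k → ∞`, tuned by `(M^(n k))⁸⟨P ; τ_{M^(n k)} P⟩_k → θ > 0`,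
if the Wilson orbits of `g k` (`betaOf (g k) = β_k`) have in-chart history up to `j k` and
couplings `< γ` before `j k` (curve data `IsCurveData S δ' K θ₁ C' h`, `0 < γ ≤ δ'`, `UVSmall S`),
then `M'^(j k) ≤ M'^W · M^(n k)` eventually. Proof, directly by `filter_upwards` (no subsequences):
* DYNAMICS (`scaleId_deep_small`): for every `ρ > 0` there are `W, l₁, g₁` such that for `g < g₁`
  every orbit point at a step `i` with `l₁ ≤ i`, `i + W < j` (deep inside a sub-`γ` in-chart
  segment) has coupling and fibre `< ρ`: basin absorption of the fibre (`norm_Ψ_le`) while the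
  coupling is frozen below `η` (`abs_φ_sub_le`), invariance of the `δ'`-bichart below `γ`
  (`2Cδ' ≤ 1 − θ`), monotone drift `φ g y ≥ g + (b/2)g³` (`4Cδ' ≤ b`: a coupling `≥ η'` passes
  `γ` within `W` steps) and ATTRACTION to the curve, `‖h g‖ ≤ C'g²`.
* ARITHMETIC: with `i := Nat.log M' (M^(n k))`, either `j k ≤ i + W` (done) or, `k` being large
  (`g k < g₁` as `|betaOf g − κ/g²| ≤ K`; `i ≥ l₁` as `M^(n k) = a_k⁻¹ → ∞`), `UVSmall S` at `θ/2`
  on the scheme's own torus (`N M'^i ≤ N M^(n k) ≤ L_k` as `a_k L_k → ∞`) bounds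
  `(M^(n k))⁸ |corr_k| ≤ θ/2` at the `ρ`-small deep point, contradicting the tuning.
-/

open scoped SchwartzMap
open MeasureTheory Filter Topology
open Literature.MathematicalPhysics.QuantumFieldTheory Literature.MathematicalPhysics.QuantumLattice
open Summit.QuantumFields.YangMills.Theses.ParabolicTrajectory

noncomputable section

namespace Summit.QuantumFields.YangMills.Cruxes.LatticeGapOnTrajectory.TrajectoryGapScaling

/-! ## Proof of the stub -/

section Helpers

variable {G : Type} [Group G] [TopologicalSpace G] [IsTopologicalGroup G] [CompactSpace G]
  [MeasurableSpace G] [BorelSpace G] {r : LatticeRep G} {M : ℕ} (S : BalabanBanachStep G r M)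

/-- Coordinate bounds from membership in the chart `[0, δ] × B̄_R`. -/
private theorem scaleId_of_mem_chart {p : ℝ × S.E} (hp : p ∈ chart S) :
    (0 ≤ p.1 ∧ p.1 ≤ S.δ) ∧ ‖p.2‖ ≤ S.R := by
  simpa only [chart, Set.mem_prod, Set.mem_Icc, Metric.mem_closedBall, dist_zero_right] using hp

-- the next three lemmas are adapted from work/stubs/stub_tubeVisited.lean (sibling stub 2)
/-- **Basin step for the coupling**: for `0 ≤ g ≤ δ' ≤ δ` and `‖y‖ ≤ R`,
`|φ g y − g| ≤ (b + C(δ' + R)) g³` (from `BalabanBanachStep.abs_φ_sub_le`). -/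
private theorem scaleId_basin_coupling {δ' g : ℝ} {y : S.E} (hδ'δ : δ' ≤ S.δ) (hg0 : 0 ≤ g)
    (hgδ' : g ≤ δ') (hy : ‖y‖ ≤ S.R) :
    |S.φ g y - g| ≤ (S.b + S.C * (δ' + S.R)) * g ^ 3 := by
  have hgδ : |g| ≤ S.δ := by rw [abs_of_nonneg hg0]; exact hgδ'.trans hδ'δ
  have h := S.abs_φ_sub_le hgδ hy
  rw [abs_of_nonneg hg0] at h
  have hC := S.C_pos.le
  have hg3 : 0 ≤ g ^ 3 := by positivity
  have hg4 : g ^ 4 ≤ δ' * g ^ 3 := by nlinarith [mul_le_mul_of_nonneg_right hgδ' hg3]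
  calc |S.φ g y - g| ≤ S.b * g ^ 3 + S.C * (g ^ 4 + g ^ 3 * S.R) := h
    _ ≤ S.b * g ^ 3 + S.C * (δ' * g ^ 3 + g ^ 3 * S.R) := by gcongr
    _ = (S.b + S.C * (δ' + S.R)) * g ^ 3 := by ring

/-- **Bichart drift**: for `0 ≤ g ≤ δ' ≤ δ`, `‖y‖ ≤ δ'` and the margin `4Cδ' ≤ b`,
`g + (b/2) g³ ≤ φ g y` (lower half of the chart `remainder` bound). -/
private theorem scaleId_bichart_drift {δ' g : ℝ} {y : S.E} (hδ'δ : δ' ≤ S.δ)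
    (hmargin : 4 * S.C * δ' ≤ S.b) (hg0 : 0 ≤ g) (hgδ' : g ≤ δ') (hy : ‖y‖ ≤ δ') :
    g + S.b / 2 * g ^ 3 ≤ S.φ g y := by
  have hgδ : |g| ≤ S.δ := by rw [abs_of_nonneg hg0]; exact hgδ'.trans hδ'δ
  have hrem := (S.remainder g y hgδ (hy.trans hδ'δ)).1
  rw [abs_of_nonneg hg0] at hrem
  have h1 := (abs_le.1 hrem).1
  have hC := S.C_pos.le; have hg3 : 0 ≤ g ^ 3 := by positivity
  have key : S.C * (g ^ 4 + g ^ 3 * ‖y‖) ≤ S.b / 2 * g ^ 3 :=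
    calc S.C * (g ^ 4 + g ^ 3 * ‖y‖) ≤ S.C * (g ^ 4 + g ^ 3 * δ') := by gcongr
      _ = S.C * (g + δ') * g ^ 3 := by ring
      _ ≤ S.C * (δ' + δ') * g ^ 3 := by gcongr
      _ = 4 * S.C * δ' / 2 * g ^ 3 := by ring
      _ ≤ S.b / 2 * g ^ 3 := by gcongr
  linarith

/-- **Bichart fibre invariance**: for `0 ≤ g ≤ δ' ≤ δ`, `‖y‖ ≤ δ'` and the margin
`2Cδ' ≤ 1 − θ`, `‖Ψ g y‖ ≤ ‖A‖‖y‖ + C(g² + ‖y‖²) ≤ θδ' + 2Cδ'² ≤ δ'`. -/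
private theorem scaleId_bichart_fibre {δ' g : ℝ} {y : S.E} (hδ'δ : δ' ≤ S.δ)
    (hmargin : 2 * S.C * δ' ≤ 1 - S.θ) (hg0 : 0 ≤ g) (hgδ' : g ≤ δ') (hy : ‖y‖ ≤ δ') :
    ‖S.Ψ g y‖ ≤ δ' := by
  have hgδ : |g| ≤ S.δ := by rw [abs_of_nonneg hg0]; exact hgδ'.trans hδ'δ
  have hrem := (S.remainder g y hgδ (hy.trans hδ'δ)).2
  have hC := S.C_pos.le; have hθ := S.θ_nonneg; have hδ'0 : 0 ≤ δ' := hg0.trans hgδ'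
  have hA : ‖S.A y‖ ≤ S.θ * δ' :=
    calc ‖S.A y‖ ≤ ‖S.A‖ * ‖y‖ := S.A.le_opNorm y
      _ ≤ S.θ * δ' := mul_le_mul S.norm_A_le hy (norm_nonneg _) hθ
  have hg2 : g ^ 2 ≤ δ' ^ 2 := pow_le_pow_left₀ hg0 hgδ' 2
  have hy2 : ‖y‖ ^ 2 ≤ δ' ^ 2 := pow_le_pow_left₀ (norm_nonneg _) hy 2
  calc ‖S.Ψ g y‖ = ‖(S.Ψ g y - S.A y) + S.A y‖ := by rw [sub_add_cancel]
    _ ≤ ‖S.Ψ g y - S.A y‖ + ‖S.A y‖ := norm_add_le _ _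
    _ ≤ S.C * (g ^ 2 + ‖y‖ ^ 2) + S.θ * δ' := add_le_add hrem hA
    _ ≤ S.C * (δ' ^ 2 + δ' ^ 2) + S.θ * δ' := by gcongr
    _ = 2 * S.C * δ' * δ' + S.θ * δ' := by ring
    _ ≤ (1 - S.θ) * δ' + S.θ * δ' := by gcongr
    _ = δ' := by ring

/-- **Deep points of long sub-`γ` orbit segments are close to the free fixed point.** Under curve
data on `[0, δ']` and `γ ≤ δ'`, for every `ρ > 0` there are `W l₁ : ℕ` and `g₁ > 0` such that for
every Wilson point `g ∈ (0, g₀]`, `g < g₁`, with in-chart history up to step `j` and couplings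
`< γ` before `j`, at every step `i` with `l₁ ≤ i`, `i + W < j` the coupling and the fibre are `< ρ`
(absorption into the `δ'`-ball while the coupling is `≤ η`; bichart invariance below `γ`; drift
`≥ (b/2)η'³` per step forces `g_i < η'`; attraction from step `l₀` and `‖h g_i‖ ≤ C'η'²`). -/
private theorem scaleId_deep_small {δ' K θ₁ C' : ℝ} {h : ℝ → S.E}
    (hcd : IsCurveData S δ' K θ₁ C' h) {γ : ℝ} (hγδ' : γ ≤ δ') {ρ : ℝ} (hρ : 0 < ρ) :
    ∃ (W l₁ : ℕ) (g₁ : ℝ), 0 < g₁ ∧ ∀ g ∈ Set.Ioc 0 S.g₀, g < g₁ → ∀ j i : ℕ,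
      (∀ l ≤ j, S.F^[l] (g, S.yW g) ∈ chart S) → (∀ l < j, (S.F^[l] (g, S.yW g)).1 < γ) →
      l₁ ≤ i → i + W < j →
      (S.F^[i] (g, S.yW g)).1 < ρ ∧ ‖(S.F^[i] (g, S.yW g)).2‖ < ρ := by
  obtain ⟨hδ', hδ'δ, hK, hθ₁, hθ₁1, hC', hdriftM, hfibM, -, -, hhC', hhalf, -, hattr⟩ := hcd
  have hb := S.b_pos; have hC := S.C_pos; have hR := S.R_pos
  have hθ0 := S.θ'_nonneg; have hθ1 := S.θ'_lt_one
  have h1θ : 0 < 1 - S.θ' := by linarith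
  -- growth factor `Kg` of the coupling below `γ`; phase-1 ceiling `η`: `C η² ≤ (1 - θ') δ' / 2`
  set c : ℝ := S.b + S.C * (δ' + S.R)
  have hc0 : 0 < c := by positivity
  set Kg : ℝ := 1 + c * γ ^ 2 with hKg
  have hKg1 : 1 ≤ Kg := le_add_of_nonneg_right (by positivity)
  have hKg0 : 0 < Kg := by linarith
  have hKgx : ∀ x : ℝ, x * Kg = x + c * γ ^ 2 * x := fun x => by rw [hKg]; ring
  set η : ℝ := min 1 ((1 - S.θ') * δ' / (2 * S.C))
  have hη0 : 0 < η := lt_min one_pos (by positivity)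
  have hCη : S.C * η ^ 2 ≤ (1 - S.θ') * δ' / 2 := by
    have h1 : η * (2 * S.C) ≤ (1 - S.θ') * δ' :=
      (le_div_iff₀ (by positivity)).1 (min_le_right _ _)
    have h2 : η ^ 2 ≤ η := pow_le_of_le_one hη0.le (min_le_left _ _) two_ne_zero
    have h3 : S.C * η ^ 2 ≤ S.C * η := mul_le_mul_of_nonneg_left h2 hC.le
    linarith
  -- absorption horizon `l₀`; target coupling `η'` (`η' ≤ ρ`, `C' η'² ≤ ρ/3`); attraction `N₁`
  obtain ⟨l₀, hl₀⟩ : ∃ l₀ : ℕ, S.θ' ^ l₀ * S.R ≤ δ' / 2 := by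
    obtain ⟨n, hn⟩ := exists_pow_lt_of_lt_one (show 0 < δ' / (2 * S.R) by positivity) hθ1
    exact ⟨n, by have := (lt_div_iff₀ (by positivity : (0 : ℝ) < 2 * S.R)).1 hn; linarith⟩
  set η' : ℝ := min (min 1 ρ) (ρ / (3 * C' + 1))
  have hη'0 : 0 < η' := lt_min (lt_min one_pos hρ) (by positivity)
  have hη'ρ : η' ≤ ρ := (min_le_left _ _).trans (min_le_right _ _)
  have hC'η' : C' * η' ^ 2 ≤ ρ / 3 := by
    have h1 : η' ≤ ρ / (3 * C' + 1) := min_le_right _ _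
    have h2 : η' ^ 2 ≤ η' :=
      pow_le_of_le_one hη'0.le ((min_le_left _ _).trans (min_le_left _ _)) two_ne_zero
    have h3 : C' / (3 * C' + 1) ≤ 1 / 3 := by rw [div_le_iff₀ (by positivity)]; linarith
    calc C' * η' ^ 2 ≤ C' * (ρ / (3 * C' + 1)) := mul_le_mul_of_nonneg_left (h2.trans h1) hC'
      _ = C' / (3 * C' + 1) * ρ := by ring
      _ ≤ 1 / 3 * ρ := mul_le_mul_of_nonneg_right h3 hρ.le
      _ = ρ / 3 := by ring
  obtain ⟨N₁, hN₁⟩ : ∃ N : ℕ, K * θ₁ ^ N * (2 * δ') ≤ ρ / 2 := by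
    obtain ⟨N, hN⟩ :=
      exists_pow_lt_of_lt_one (show 0 < ρ / 2 / (2 * K * δ' + 1) by positivity) hθ₁1
    refine ⟨N, ?_⟩
    have h1 : K * θ₁ ^ N * (2 * δ') ≤ K * (ρ / 2 / (2 * K * δ' + 1)) * (2 * δ') := by gcongr
    refine h1.trans ?_
    rw [show K * (ρ / 2 / (2 * K * δ' + 1)) * (2 * δ') = ρ / 2 * (2 * K * δ' / (2 * K * δ' + 1))
      by ring]
    have h2 : 2 * K * δ' / (2 * K * δ' + 1) ≤ 1 := by rw [div_le_one (by positivity)]; linarith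
    have h3 : 0 ≤ 2 * K * δ' / (2 * K * δ' + 1) := by positivity
    nlinarith
  -- drift quantum `d` and escape time `W`
  set d : ℝ := S.b / 2 * η' ^ 3
  have hd0 : 0 < d := by positivity
  obtain ⟨W, hWd⟩ : ∃ W : ℕ, γ ≤ W * d := ⟨⌈γ / d⌉₊, (div_le_iff₀ hd0).1 (Nat.le_ceil _)⟩
  refine ⟨W, l₀ + N₁, η / Kg ^ l₀, by positivity, ?_⟩
  intro g hg hg₁ j i hchart hlt hli hij
  have hgpos : 0 < g := hg.1
  have hij' : i < j := by omega
  -- the orbit and its chart bounds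
  set p : ℕ → ℝ × S.E := fun l => S.F^[l] (g, S.yW g)
  have psucc : ∀ l, p (l + 1) = S.F (p l) := fun l => Function.iterate_succ_apply' _ _ _
  have Ffst : ∀ q : ℝ × S.E, (S.F q).1 = S.φ q.1 q.2 := fun q => rfl
  have Fsnd : ∀ q : ℝ × S.E, (S.F q).2 = S.Ψ q.1 q.2 := fun q => rfl
  have hc0' : ∀ l ≤ j, 0 ≤ (p l).1 := fun l hl => (scaleId_of_mem_chart S (hchart l hl)).1.1
  have hcδ : ∀ l ≤ j, (p l).1 ≤ S.δ := fun l hl => (scaleId_of_mem_chart S (hchart l hl)).1.2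
  have hcR : ∀ l ≤ j, ‖(p l).2‖ ≤ S.R := fun l hl => (scaleId_of_mem_chart S (hchart l hl)).2
  have hcγ : ∀ l < j, (p l).1 < γ := hlt
  -- (1) growth `g_l ≤ g Kg^l` up to `j`; so the coupling stays `≤ η` up to the absorption horizon
  have H1 : ∀ l ≤ j, (p l).1 ≤ g * Kg ^ l := by
    intro l
    induction l with
    | zero => intro _; show (S.F^[0] (g, S.yW g)).1 ≤ g * Kg ^ 0; simp
    | succ l ih =>
      intro hl
      have hl' : l < j := hl
      have hprev := ih hl'.le; have hx0 := hc0' l hl'.le; have hxγ := hcγ l hl'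
      have hhi : S.φ (p l).1 (p l).2 - (p l).1 ≤ c * (p l).1 ^ 3 :=
        (abs_le.1 (scaleId_basin_coupling S hδ'δ hx0 (hxγ.le.trans hγδ') (hcR l hl'.le))).2
      have hsq : (p l).1 ^ 2 ≤ γ ^ 2 := pow_le_pow_left₀ hx0 hxγ.le 2
      have h3 : c * (p l).1 ^ 3 ≤ c * γ ^ 2 * (p l).1 :=
        calc c * (p l).1 ^ 3 = c * (p l).1 ^ 2 * (p l).1 := by ring
          _ ≤ c * γ ^ 2 * (p l).1 := by gcongr
      have hK1 := hKgx (p l).1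
      rw [psucc, Ffst]
      calc S.φ (p l).1 (p l).2 ≤ (p l).1 * Kg := by linarith
        _ ≤ g * Kg ^ l * Kg := mul_le_mul_of_nonneg_right hprev hKg0.le
        _ = g * Kg ^ (l + 1) := by ring
  have hgη : g * Kg ^ l₀ < η := (lt_div_iff₀ (by positivity)).1 hg₁
  have hsmall : ∀ l ≤ l₀, (p l).1 ≤ η := by
    intro l hl
    have h2 : g * Kg ^ l ≤ g * Kg ^ l₀ :=
      mul_le_mul_of_nonneg_left (pow_le_pow_right₀ hKg1 hl) hgpos.le
    linarith [H1 l (by omega)]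
  -- (2) absorption `‖y_l‖ ≤ θ'^l R + δ'/2` for `l ≤ l₀`; (3) bichart invariance from `l₀` to `j`
  have H2 : ∀ l ≤ l₀, ‖(p l).2‖ ≤ S.θ' ^ l * S.R + δ' / 2 := by
    intro l
    induction l with
    | zero =>
      intro _; have h0 : ‖(p 0).2‖ ≤ S.R := hcR 0 (Nat.zero_le _)
      simp only [pow_zero, one_mul]; linarith
    | succ l ih =>
      intro hl
      have hl' : l < l₀ := hl; have hprev := ih hl'.le; have hlj : l ≤ j := by omega
      have hx0 := hc0' l hlj
      have hxδ : |(p l).1| ≤ S.δ := by rw [abs_of_nonneg hx0]; exact hcδ l hlj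
      have hsq : (p l).1 ^ 2 ≤ η ^ 2 := pow_le_pow_left₀ hx0 (hsmall l hl'.le) 2
      have hCx : S.C * (p l).1 ^ 2 ≤ (1 - S.θ') * δ' / 2 :=
        (mul_le_mul_of_nonneg_left hsq hC.le).trans hCη
      rw [psucc, Fsnd]
      calc ‖S.Ψ (p l).1 (p l).2‖ ≤ S.θ' * ‖(p l).2‖ + S.C * (p l).1 ^ 2 :=
            S.norm_Ψ_le hxδ (hcR l hlj)
        _ ≤ S.θ' * (S.θ' ^ l * S.R + δ' / 2) + (1 - S.θ') * δ' / 2 :=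
            add_le_add (mul_le_mul_of_nonneg_left hprev hθ0) hCx
        _ = S.θ' ^ (l + 1) * S.R + δ' / 2 := by ring
  have hq2 : ‖(p l₀).2‖ ≤ δ' := by have := H2 l₀ le_rfl; linarith
  have H3 : ∀ m, l₀ + m ≤ j → ‖(p (l₀ + m)).2‖ ≤ δ' := by
    intro m
    induction m with
    | zero => intro _; simpa using hq2
    | succ m ih =>
      intro hm
      have hm' : l₀ + m < j := by omega
      rw [show l₀ + (m + 1) = (l₀ + m) + 1 by ring, psucc, Fsnd]
      exact scaleId_bichart_fibre S hδ'δ hfibM (hc0' _ hm'.le) ((hcγ _ hm').le.trans hγδ')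
        (ih hm'.le)
  have hfibδ' : ∀ l, l₀ ≤ l → l ≤ j → ‖(p l).2‖ ≤ δ' := fun l h1 h2 => by
    obtain ⟨m, rfl⟩ : ∃ m, l = l₀ + m := ⟨l - l₀, by omega⟩
    exact H3 m h2
  -- (4) escape: the coupling at the deep step `i` is below `η'`
  have H4 : (p i).1 < η' := by
    refine not_le.1 fun hge => ?_
    have hclimb : ∀ m, i + m < j → η' + m * d ≤ (p (i + m)).1 := by
      intro m
      induction m with
      | zero => intro _; simpa using hge
      | succ m ih =>
        intro hm
        have hm' : i + m < j := by omega
        have hprev := ih hm'; have hx0 := hc0' _ hm'.le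
        have hdr := scaleId_bichart_drift S hδ'δ hdriftM hx0 ((hcγ _ hm').le.trans hγδ')
          (hfibδ' _ (by omega) hm'.le)
        have hge' : η' ≤ (p (i + m)).1 := le_trans (le_add_of_nonneg_right (by positivity)) hprev
        have hmul : d ≤ S.b / 2 * (p (i + m)).1 ^ 3 :=
          mul_le_mul_of_nonneg_left (pow_le_pow_left₀ hη'0.le hge' 3) (by positivity)
        rw [show i + (m + 1) = (i + m) + 1 by ring, psucc, Ffst]
        push_cast
        linarith
    linarith [hclimb W hij, hcγ (i + W) hij]
  -- (5) attraction from step `l₀`: the fibre at the deep step `i = l₀ + m`, `m ≥ N₁`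
  obtain ⟨m, rfl⟩ : ∃ m, i = l₀ + m := ⟨i - l₀, by omega⟩
  have hN₁m : N₁ ≤ m := by omega
  have hiter : ∀ i', S.F^[i'] (p l₀) = p (l₀ + i') := by
    intro i'
    show S.F^[i'] (S.F^[l₀] (g, S.yW g)) = S.F^[l₀ + i'] (g, S.yW g)
    rw [← Function.iterate_add_apply, Nat.add_comm]
  have hseg : ∀ i' ≤ m, (S.F^[i'] (p l₀)).1 ∈ Set.Icc 0 δ' ∧ ‖(S.F^[i'] (p l₀)).2‖ ≤ δ' := by
    intro i' hi'
    have hlt' : l₀ + i' < j := by omega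
    rw [hiter]
    exact ⟨⟨hc0' _ hlt'.le, (hcγ _ hlt').le.trans hγδ'⟩, hfibδ' _ (Nat.le_add_right _ _) hlt'.le⟩
  have hatt := hattr (p l₀) m hseg
  rw [hiter] at hatt
  have hl₀j : l₀ < j := by omega
  have hq1 : (p l₀).1 ∈ Set.Icc 0 δ' := ⟨hc0' _ hl₀j.le, (hcγ _ hl₀j).le.trans hγδ'⟩
  have hq3 : ‖(p l₀).2 - h (p l₀).1‖ ≤ 2 * δ' :=
    (norm_sub_le _ _).trans (by linarith [hhalf _ hq1])
  have hθpow : θ₁ ^ m ≤ θ₁ ^ N₁ := pow_le_pow_of_le_one hθ₁ hθ₁1.le hN₁m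
  have hdist : ‖(p (l₀ + m)).2 - h (p (l₀ + m)).1‖ ≤ ρ / 2 :=
    calc ‖(p (l₀ + m)).2 - h (p (l₀ + m)).1‖ ≤ K * θ₁ ^ m * ‖(p l₀).2 - h (p l₀).1‖ := hatt
      _ ≤ K * θ₁ ^ N₁ * (2 * δ') := by gcongr
      _ ≤ ρ / 2 := hN₁
  have hx0 := hc0' _ hij'.le
  have hhx : ‖h (p (l₀ + m)).1‖ ≤ ρ / 3 := by
    have hsq : (p (l₀ + m)).1 ^ 2 ≤ η' ^ 2 := pow_le_pow_left₀ hx0 H4.le 2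
    exact (hhC' _ ⟨hx0, (hcγ _ hij').le.trans hγδ'⟩).trans
      ((mul_le_mul_of_nonneg_left hsq hC').trans hC'η')
  have hsum := norm_add_le ((p (l₀ + m)).2 - h (p (l₀ + m)).1) (h (p (l₀ + m)).1)
  rw [sub_add_cancel] at hsum
  exact ⟨H4.trans_le hη'ρ, by linarith⟩

end Helpers

/-- **Stub 4 of the line `trajectory-gap-scaling` — scale identification (where the tuning is
consumed).** With `i := Nat.log M' (M^(n k))` (`M'^i ≤ M^(n k) < M'^(i+1)`) and `Λ := M'^W`:
either `j k ≤ i + W`, or — `k` being large (`g k < g₁` since `β_k → ∞` and `|betaOf g − κ/g²| ≤ K`;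
`i ≥ l₁` since `M^(n k) = a_k⁻¹ → ∞`) — `scaleId_deep_small` makes the orbit point at step `i`
`ρ`-close to the origin, and `UVSmall S` at `ε' = θ/2` on the scheme's own torus
(`N M'^i ≤ N M^(n k) ≤ L_k` from `a_k L_k → ∞`, separation `M^(n k) ∈ [M'^i, M'·M'^i]`) gives
`(M^(n k))⁸ |corr_k| ≤ θ/2`, against the tuning (`> θ/2` eventually). -/
theorem stub_scaleIdentification : ScaleIdentification := by
  intro G _ _ _ _ _ _ r M' S δ' K θ₁ C' h hcd γ γ' ε hγ hγδ' huv M θ sch n g j hθ hshape hβ htune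
    hgj
  obtain ⟨ρ, hρ, N, hUV⟩ := huv (θ / 2) (half_pos hθ)
  obtain ⟨W, l₁, g₁, hg₁, hdeep⟩ := scaleId_deep_small S hcd hγδ' hρ
  have hM'1 : 1 < M' := by have := S.two_le_M; omega
  have hM'r : (1 : ℝ) < M' := S.one_lt_M
  have hM'pos : (0 : ℝ) < M' := one_pos.trans hM'r
  -- the scheme's unit `M^(n k) = a_k⁻¹` is positive and tends to infinity; the eventualities
  have hMpos : ∀ k, (0 : ℝ) < (M : ℝ) ^ n k := fun k => by
    have := sch.a_pos k; rwa [hshape k, inv_pos] at this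
  have hMtop : Tendsto (fun k => (M : ℝ) ^ n k) atTop atTop := by
    have h1 : Tendsto sch.a atTop (𝓝[>] 0) :=
      tendsto_nhdsWithin_iff.2 ⟨sch.tendsto_a, Eventually.of_forall fun k => sch.a_pos k⟩
    refine h1.inv_tendsto_nhdsGT_zero.congr fun k => ?_
    show (sch.a k)⁻¹ = (M : ℝ) ^ n k
    rw [hshape k, inv_inv]
  have e_β : ∀ᶠ k in atTop, S.K + S.κ / g₁ ^ 2 + 1 ≤ sch.β k := hβ.eventually_ge_atTop _
  have e_vol : ∀ᶠ k in atTop, (N : ℝ) ≤ sch.a k * sch.L k := sch.tendsto_L.eventually_ge_atTop _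
  have e_big : ∀ᶠ k in atTop, ((M' ^ l₁ : ℕ) : ℝ) ≤ (M : ℝ) ^ n k := hMtop.eventually_ge_atTop _
  have e_tune : ∀ᶠ k in atTop, θ / 2 < ((M : ℝ) ^ n k) ^ 8 *
      latticeConnectedCorr r.ρ (sch.β k) (sch.side k) r.curvature.F r.curvature.F (M ^ n k) :=
    htune.eventually (lt_mem_nhds (half_lt_self hθ))
  refine ⟨(M' : ℝ) ^ W, pow_pos hM'pos W, ?_⟩
  filter_upwards [hgj, e_β, e_vol, e_big, e_tune] with k hk hβk hvol hbig htk
  obtain ⟨hg, hgβ, hchart, hlt, -⟩ := hk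
  -- the scheme's own scale in chart steps: `i := log_{M'} (M ^ n k)`
  have h0 : (0 : ℝ) < ((M ^ n k : ℕ) : ℝ) := by push_cast; exact hMpos k
  have hMk' : 0 < M ^ n k := by exact_mod_cast h0
  set i : ℕ := Nat.log M' (M ^ n k)
  have hi1 : M' ^ i ≤ M ^ n k := Nat.pow_log_le_self M' hMk'.ne'
  have hi2 : M ^ n k < M' ^ (i + 1) := Nat.lt_pow_succ_log_self hM'1 _
  have hi1r : (M' : ℝ) ^ i ≤ (M : ℝ) ^ n k := by exact_mod_cast hi1
  have hl₁i : l₁ ≤ i := Nat.le_log_of_pow_le hM'1 (by exact_mod_cast hbig)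
  rcases le_or_gt (j k) (i + W) with hle | hij
  · calc (M' : ℝ) ^ j k ≤ (M' : ℝ) ^ (i + W) := pow_le_pow_right₀ hM'r.le hle
      _ = (M' : ℝ) ^ W * (M' : ℝ) ^ i := by ring
      _ ≤ (M' : ℝ) ^ W * (M : ℝ) ^ n k := mul_le_mul_of_nonneg_left hi1r (by positivity)
  -- otherwise `g k < g₁`, the deep point at step `i` is `ρ`-small, and `UVSmall` beats the tuning
  exfalso
  have hgg₁ : g k < g₁ := by
    have h1 := (abs_le.1 (S.betaOf_sub_le (g k) hg)).2
    have h2 : S.K + S.κ / g₁ ^ 2 + 1 ≤ S.betaOf (g k) := by rw [hgβ]; exact hβk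
    exact lt_of_pow_lt_pow_left₀ 2 hg₁.le
      ((div_lt_div_iff_of_pos_left S.κ_pos (pow_pos hg₁ 2) (pow_pos hg.1 2)).1 (by linarith))
  obtain ⟨hcoup, hfib⟩ := hdeep (g k) hg hgg₁ (j k) i hchart hlt hl₁i hij
  have hNL : N * M' ^ i ≤ sch.L k := by
    have h1 : (N : ℝ) * (M : ℝ) ^ n k ≤ sch.L k := by
      have := hvol; rwa [hshape k, inv_mul_eq_div, le_div_iff₀ (hMpos k)] at this
    have h2 : ((N * M' ^ i : ℕ) : ℝ) ≤ sch.L k := by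
      push_cast; exact (mul_le_mul_of_nonneg_left hi1r (Nat.cast_nonneg N)).trans h1
    exact_mod_cast h2
  have hn2 : M ^ n k ≤ M' * M' ^ i := by rw [← pow_succ']; exact hi2.le
  have hU := hUV (g k) hg i (fun l hl => hchart l (by omega)) hcoup hfib (sch.L k) hNL
    (M ^ n k) hi1 hn2
  rw [hgβ] at hU
  push_cast at hU
  have htk' : θ / 2 < ((M : ℝ) ^ n k) ^ 8 *
      latticeConnectedCorr r.ρ (sch.β k) (2 * sch.L k + 1) r.curvature.F r.curvature.F (M ^ n k) :=
    htk
  have habs := mul_le_mul_of_nonneg_left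
    (le_abs_self (latticeConnectedCorr r.ρ (sch.β k) (2 * sch.L k + 1) r.curvature.F
      r.curvature.F (M ^ n k))) (by positivity : (0 : ℝ) ≤ ((M : ℝ) ^ n k) ^ 8)
  linarith

end Summit.QuantumFields.YangMills.Cruxes.LatticeGapOnTrajectory.TrajectoryGapScaling

end
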